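import Mathlib
import Summits.ValiantsHypothesis.ValiantsHypothesis.Theorems.BinomialElusiveBinomialCandidateCrossCapEvaluation

/-!
# Crux `BinomialElusive.BinomialCandidate` (stmt-ValiantsHypothesis-7392), line `registered` —
# stub `stub_nondegenerateCorankTwo` (skeleton v6), pieces H and H': evaluation lemmas

Two registered helper stubs of the nondegenerate corank-two package, both generalising the landed
`crossCap_evaluation` (file `…CrossCapEvaluation`):

* `evaluation_polynomial_sigma` (H') — `crossCap_evaluation` with the index type `Fin m` replaced
  by an arbitrary finite type `σ`: `A := ℂ⟦W_s : s ∈ σ⟧`; if `C D = U F₀ + V F₁` in `A⟦X⟧` for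
  polynomials `F₀, F₁ ∈ ℂ[W][X]`, and Laurent series `T_s`, `x` of positive order make `F₀(T, x)`,
  `F₁(T, x)` vanish below `t^n`, then `(truncTotal n D)(T)` vanishes below `t^n`;
* `evaluation_powerSeries` (H) — the same conclusion when `F₀, F₁ ∈ A⟦X⟧` are power series and the
  evaluation hypotheses are imposed on their polynomial truncations
  `τF_a := Σ_{j<n} (truncTotal n [X^j] F_a) X^j ∈ ℂ[W][X]`.

Both follow from one statement `CorankTwoEvaluation.eval_truncTotal_vanish`: for polynomials
`G₀, G₁ ∈ ℂ[W][X]` evaluating into `t^n ℂ⟦t⟧` it suffices that `C D - U G₀ - V G₁` be *small*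
(no monomial `W^d X^j` with `j + |d| < n`).  For (H') this difference is `0`; for (H), with
`G_a := τF_a`, it equals `U (F₀ - τF₀) + V (F₁ - τF₁)`, and `F_a - τF_a` is small.  The proof of the
common statement is the template's: with `τU, τV` the truncations of `U, V` and
`P₀ := C (truncTotal n D) - τU G₀ - τV G₁ ∈ ℂ[W][X]`, the series
`P₀ = (C (truncTotal n D) - C D) + (C D - U G₀ - V G₁) + (U - τU) G₀ + (V - τV) G₁` is small, a
small polynomial evaluates into `t^n ℂ⟦t⟧` at series of positive order, and `τU G₀`, `τV G₁`
evaluate into `t^n ℂ⟦t⟧` by hypothesis.  The index-free lemmas `CrossCap.vanish_*` of the template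
are reused; its `Fin m`-specific lemmas are re-proved here for a general `σ`.
-/

-- layout Summits/ValiantsHypothesis/ValiantsHypothesis forces the duplicated namespace component
set_option linter.dupNamespace false

noncomputable section

namespace Summit.ValiantsHypothesis.ValiantsHypothesis.Theorems.BinomialCandidateStubs

open scoped BigOperators

namespace CorankTwoEvaluation

/-! ## Evaluating polynomials with only high-degree monomials (index type `σ`) -/

section Aeval

variable {σ : Type*} (T : σ → LaurentSeries ℂ) (hT : ∀ i, ∀ g < (1 : ℤ), (T i).coeff g = 0)
include hT

/-- A polynomial all of whose monomials have total degree `≥ e`, evaluated at series of positive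
order, vanishes below `t^e` (`CrossCap.vanish_aeval` for a general index type). -/
theorem aeval_vanish (a : MvPolynomial σ ℂ) (e : ℕ)
    (ha : ∀ d : σ →₀ ℕ, d.degree < e → MvPolynomial.coeff d a = 0) :
    ∀ g < (e : ℤ), (MvPolynomial.aeval T a).coeff g = 0 := by
  rw [MvPolynomial.as_sum a, map_sum]
  refine CrossCap.vanish_sum _ _ fun d hd => ?_
  rw [MvPolynomial.aeval_monomial, Finsupp.prod]
  have hprod := CrossCap.vanish_prod d.support (fun i => T i ^ d i) (fun i => (d i : ℤ))
    (fun i _ => by simpa using CrossCap.vanish_pow (hT i) (d i))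
  have hdeg : (e : ℤ) ≤ ∑ i ∈ d.support, (d i : ℤ) := by
    have : e ≤ d.degree := by
      by_contra h
      exact (MvPolynomial.mem_support_iff.mp hd) (ha d (by omega))
    rw [Finsupp.degree_apply] at this
    exact_mod_cast this
  have := CrossCap.vanish_mul (CrossCap.vanish_algebraMap (MvPolynomial.coeff d a)) hprod
  rw [zero_add] at this
  exact CrossCap.vanish_mono hdeg this

variable (x : LaurentSeries ℂ) (hx : ∀ g < (1 : ℤ), x.coeff g = 0)
include hx

/-- A polynomial in `X` over `ℂ[W]` all of whose monomials `W^d X^j` have `j + |d| ≥ n`, evaluated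
at `W := T`, `X := x` (positive orders), vanishes below `t^n` (`CrossCap.vanish_eval₂` for a
general index type). -/
theorem eval₂_vanish (n : ℕ) (P : Polynomial (MvPolynomial σ ℂ))
    (hP : ∀ (j : ℕ) (d : σ →₀ ℕ), j + d.degree < n → MvPolynomial.coeff d (P.coeff j) = 0) :
    ∀ g < (n : ℤ), (Polynomial.eval₂ (MvPolynomial.aeval T).toRingHom x P).coeff g = 0 := by
  rw [Polynomial.eval₂_eq_sum, Polynomial.sum_def]
  refine CrossCap.vanish_sum _ _ fun j _ => ?_
  change ∀ g < (n : ℤ), (MvPolynomial.aeval T (P.coeff j) * x ^ j).coeff g = 0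
  by_cases hjn : j < n
  · have h1 := aeval_vanish T hT (P.coeff j) (n - j) fun d hd => hP j d (by omega)
    have := CrossCap.vanish_mul h1 (CrossCap.vanish_pow hx j)
    refine CrossCap.vanish_mono (le_of_eq ?_) this
    push_cast [Nat.cast_sub hjn.le]
    ring
  · have h1 := aeval_vanish T hT (P.coeff j) 0 fun d hd => absurd hd (Nat.not_lt_zero _)
    have := CrossCap.vanish_mul h1 (CrossCap.vanish_pow hx j)
    refine CrossCap.vanish_mono ?_ this
    push_cast
    omega

end Aeval

/-! ## Small elements of `A⟦X⟧`: no monomial `W^d X^j` with `j + |d| < n` (index type `σ`) -/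

section Small

variable {σ : Type*} {n : ℕ}

/-- Small series form an ideal: a small series times anything is small. -/
theorem small_mul_left {Φ : PowerSeries (MvPowerSeries σ ℂ)}
    (hΦ : ∀ (j : ℕ) (d : σ →₀ ℕ), j + d.degree < n →
      MvPowerSeries.coeff d (PowerSeries.coeff j Φ) = 0)
    (Ψ : PowerSeries (MvPowerSeries σ ℂ)) :
    ∀ (j : ℕ) (d : σ →₀ ℕ), j + d.degree < n →
      MvPowerSeries.coeff d (PowerSeries.coeff j (Φ * Ψ)) = 0 := by
  classical
  intro j d hjd
  rw [PowerSeries.coeff_mul, map_sum]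
  refine Finset.sum_eq_zero fun jj hjj => ?_
  rw [MvPowerSeries.coeff_mul]
  refine Finset.sum_eq_zero fun dd hdd => ?_
  rw [Finset.HasAntidiagonal.mem_antidiagonal] at hjj hdd
  have h1 : jj.1 ≤ j := by rw [← hjj]; exact Nat.le_add_right _ _
  have h2 : dd.1.degree ≤ d.degree := by rw [← hdd, map_add]; exact Nat.le_add_right _ _
  rw [hΦ jj.1 dd.1 (by omega), zero_mul]

/-- Anything times a small series is small. -/
theorem small_mul_right (Ψ : PowerSeries (MvPowerSeries σ ℂ)) {Φ : PowerSeries (MvPowerSeries σ ℂ)}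
    (hΦ : ∀ (j : ℕ) (d : σ →₀ ℕ), j + d.degree < n →
      MvPowerSeries.coeff d (PowerSeries.coeff j Φ) = 0) :
    ∀ (j : ℕ) (d : σ →₀ ℕ), j + d.degree < n →
      MvPowerSeries.coeff d (PowerSeries.coeff j (Ψ * Φ)) = 0 := by
  rw [mul_comm]
  exact small_mul_left hΦ Ψ

/-- The embedding `ℂ[W][X] → A⟦X⟧` on coefficients. -/
theorem coeff_coeff_iota (P : Polynomial (MvPolynomial σ ℂ)) (j : ℕ) (d : σ →₀ ℕ) :
    MvPowerSeries.coeff d (PowerSeries.coeff j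
      ((P.map MvPolynomial.coeToMvPowerSeries.ringHom : Polynomial (MvPowerSeries σ ℂ)) :
        PowerSeries (MvPowerSeries σ ℂ))) = MvPolynomial.coeff d (P.coeff j) := by
  simp [Polynomial.coeff_coe]

variable [Finite σ]

/-- Every element of `A⟦X⟧` is congruent to a polynomial modulo small series: subtract the
truncation `Σ_{j<n} (truncTotal n Φ_j) X^j`. -/
theorem small_self_sub_trunc (Φ : PowerSeries (MvPowerSeries σ ℂ)) :
    ∀ (j : ℕ) (d : σ →₀ ℕ), j + d.degree < n →
      MvPowerSeries.coeff d (PowerSeries.coeff j (Φ -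
        (((∑ j' ∈ Finset.range n, Polynomial.monomial j'
          (MvPowerSeries.truncTotal n (PowerSeries.coeff j' Φ))).map
            MvPolynomial.coeToMvPowerSeries.ringHom : Polynomial (MvPowerSeries σ ℂ)) :
          PowerSeries (MvPowerSeries σ ℂ)))) = 0 := by
  classical
  intro j d hjd
  rw [map_sub, map_sub, coeff_coeff_iota, Polynomial.finsetSum_coeff]
  simp only [Polynomial.coeff_monomial, Finset.sum_ite_eq', Finset.mem_range]
  rw [if_pos (by omega), MvPowerSeries.coeff_truncTotal _ (by omega), sub_self]

/-- The constant polynomial `C (truncTotal n D)` is congruent to the constant series `C D`. -/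
theorem small_C_trunc_sub_C (D : MvPowerSeries σ ℂ) :
    ∀ (j : ℕ) (d : σ →₀ ℕ), j + d.degree < n →
      MvPowerSeries.coeff d (PowerSeries.coeff j
        ((((Polynomial.C (MvPowerSeries.truncTotal n D)).map MvPolynomial.coeToMvPowerSeries.ringHom :
            Polynomial (MvPowerSeries σ ℂ)) : PowerSeries (MvPowerSeries σ ℂ)) -
          PowerSeries.C D)) = 0 := by
  intro j d hjd
  rw [map_sub, map_sub, coeff_coeff_iota, Polynomial.coeff_C, PowerSeries.coeff_C]
  split_ifs with hj
  · rw [MvPowerSeries.coeff_truncTotal _ (by omega), sub_self]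
  · simp

/-- **Common core of (H) and (H').**  If `C D - U G₀ - V G₁` is small in `A⟦X⟧` for polynomials
`G₀, G₁ ∈ ℂ[W][X]` which, evaluated at Laurent series `T_s`, `x` of positive order, vanish below
`t^n`, then `(truncTotal n D)(T)` vanishes below `t^n`. -/
theorem eval_truncTotal_vanish (G₀ G₁ : Polynomial (MvPolynomial σ ℂ)) (D : MvPowerSeries σ ℂ)
    (U V : PowerSeries (MvPowerSeries σ ℂ)) (T : σ → LaurentSeries ℂ) (x : LaurentSeries ℂ)
    (hS : ∀ (j : ℕ) (d : σ →₀ ℕ), j + d.degree < n →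
      MvPowerSeries.coeff d (PowerSeries.coeff j (PowerSeries.C D -
        U * ((G₀.map MvPolynomial.coeToMvPowerSeries.ringHom : Polynomial (MvPowerSeries σ ℂ)) :
          PowerSeries (MvPowerSeries σ ℂ)) -
        V * ((G₁.map MvPolynomial.coeToMvPowerSeries.ringHom : Polynomial (MvPowerSeries σ ℂ)) :
          PowerSeries (MvPowerSeries σ ℂ)))) = 0)
    (hT : ∀ i, ∀ g : ℤ, g < 1 → (T i).coeff g = 0) (hx : ∀ g : ℤ, g < 1 → x.coeff g = 0)
    (hG₀ : ∀ g : ℤ, g < n → (Polynomial.eval₂ (MvPolynomial.aeval T).toRingHom x G₀).coeff g = 0)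
    (hG₁ : ∀ g : ℤ, g < n → (Polynomial.eval₂ (MvPolynomial.aeval T).toRingHom x G₁).coeff g = 0) :
    ∀ g : ℤ, g < n → (MvPolynomial.aeval T (MvPowerSeries.truncTotal n D)).coeff g = 0 := by
  -- the embedding `ℂ[W][X] → A⟦X⟧` as a ring homomorphism
  set ι : Polynomial (MvPolynomial σ ℂ) →+* PowerSeries (MvPowerSeries σ ℂ) :=
    (Polynomial.coeToPowerSeries.ringHom).comp
      (Polynomial.mapRingHom MvPolynomial.coeToMvPowerSeries.ringHom) with hι
  have hιapp : ∀ P : Polynomial (MvPolynomial σ ℂ), ι P =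
      ((P.map MvPolynomial.coeToMvPowerSeries.ringHom : Polynomial (MvPowerSeries σ ℂ)) :
        PowerSeries (MvPowerSeries σ ℂ)) := fun P => rfl
  -- polynomial truncations of `U`, `V`
  set τU : Polynomial (MvPolynomial σ ℂ) := ∑ j' ∈ Finset.range n, Polynomial.monomial j'
    (MvPowerSeries.truncTotal n (PowerSeries.coeff j' U)) with hτU
  set τV : Polynomial (MvPolynomial σ ℂ) := ∑ j' ∈ Finset.range n, Polynomial.monomial j'
    (MvPowerSeries.truncTotal n (PowerSeries.coeff j' V)) with hτV
  set P₀ : Polynomial (MvPolynomial σ ℂ) :=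
    Polynomial.C (MvPowerSeries.truncTotal n D) - τU * G₀ - τV * G₁ with hP₀
  -- `ι P₀` is small
  have key : ι P₀ = (ι (Polynomial.C (MvPowerSeries.truncTotal n D)) - PowerSeries.C D) +
      (PowerSeries.C D - U * ι G₀ - V * ι G₁) + (U - ι τU) * ι G₀ + (V - ι τV) * ι G₁ := by
    rw [hP₀, map_sub, map_sub, map_mul, map_mul]
    ring
  have hsmall : ∀ (j : ℕ) (d : σ →₀ ℕ), j + d.degree < n →
      MvPowerSeries.coeff d (PowerSeries.coeff j (ι P₀)) = 0 := by
    intro j d hjd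
    rw [key, map_add, map_add, map_add, map_add, map_add, map_add, hιapp, hιapp τU, hιapp τV,
      hιapp G₀, hιapp G₁, small_C_trunc_sub_C D j d hjd, hS j d hjd,
      small_mul_left (small_self_sub_trunc U) _ j d hjd,
      small_mul_left (small_self_sub_trunc V) _ j d hjd, add_zero, add_zero, add_zero]
  have hP₀coeff : ∀ (j : ℕ) (d : σ →₀ ℕ), j + d.degree < n →
      MvPolynomial.coeff d (P₀.coeff j) = 0 := by
    intro j d hjd
    rw [← coeff_coeff_iota, ← hιapp]
    exact hsmall j d hjd
  -- evaluate
  have hev := eval₂_vanish T hT x hx n P₀ hP₀coeff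
  have hevU := eval₂_vanish T hT x hx 0 τU fun j d hjd => absurd hjd (Nat.not_lt_zero _)
  have hevV := eval₂_vanish T hT x hx 0 τV fun j d hjd => absurd hjd (Nat.not_lt_zero _)
  have h1 := CrossCap.vanish_mul hevU hG₀
  have h2 := CrossCap.vanish_mul hevV hG₁
  simp only [Nat.cast_zero, zero_add] at h1 h2
  have heq : MvPolynomial.aeval T (MvPowerSeries.truncTotal n D) =
      Polynomial.eval₂ (MvPolynomial.aeval T).toRingHom x P₀ +
        Polynomial.eval₂ (MvPolynomial.aeval T).toRingHom x τU *
          Polynomial.eval₂ (MvPolynomial.aeval T).toRingHom x G₀ +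
        Polynomial.eval₂ (MvPolynomial.aeval T).toRingHom x τV *
          Polynomial.eval₂ (MvPolynomial.aeval T).toRingHom x G₁ := by
    rw [hP₀, Polynomial.eval₂_sub, Polynomial.eval₂_sub, Polynomial.eval₂_mul, Polynomial.eval₂_mul,
      Polynomial.eval₂_C]
    simp only [AlgHom.toRingHom_eq_coe, RingHom.coe_coe]
    ring
  rw [heq]
  exact CrossCap.vanish_add (CrossCap.vanish_add hev h1) h2

end Small

end CorankTwoEvaluation

open CorankTwoEvaluation in
/-- **(H') Evaluation of an `A⟦X⟧`-ideal membership, general index type** (helper of the stub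
`stub_nondegenerateCorankTwo`; `crossCap_evaluation` with `Fin m` replaced by a finite type `σ`).
`A = ℂ⟦W_s : s ∈ σ⟧`; if `C D = U F₀ + V F₁` in `A⟦X⟧` for polynomials `F₀, F₁ ∈ ℂ[W][X]`, and
Laurent series `T_s`, `x` of positive order make `F₀(T, x)` and `F₁(T, x)` vanish below `t^n`,
then the truncation `truncTotal n D ∈ ℂ[W]` evaluated at `T` vanishes below `t^n`. -/
theorem evaluation_polynomial_sigma :
    ∀ (σ : Type) [Fintype σ] [DecidableEq σ] (n : ℕ) (F₀ F₁ : Polynomial (MvPolynomial σ ℂ))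
      (D : MvPowerSeries σ ℂ) (U V : PowerSeries (MvPowerSeries σ ℂ)) (T : σ → LaurentSeries ℂ) (x : LaurentSeries ℂ),
      PowerSeries.C D =
        U * ((F₀.map MvPolynomial.coeToMvPowerSeries.ringHom : Polynomial (MvPowerSeries σ ℂ)) :
          PowerSeries (MvPowerSeries σ ℂ)) +
        V * ((F₁.map MvPolynomial.coeToMvPowerSeries.ringHom : Polynomial (MvPowerSeries σ ℂ)) :
          PowerSeries (MvPowerSeries σ ℂ)) →
      (∀ i, ∀ g : ℤ, g < 1 → (T i).coeff g = 0) → (∀ g : ℤ, g < 1 → x.coeff g = 0) →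
      (∀ g : ℤ, g < n → (Polynomial.eval₂ (MvPolynomial.aeval T).toRingHom x F₀).coeff g = 0) →
      (∀ g : ℤ, g < n → (Polynomial.eval₂ (MvPolynomial.aeval T).toRingHom x F₁).coeff g = 0) →
      ∀ g : ℤ, g < n → (MvPolynomial.aeval T (MvPowerSeries.truncTotal n D)).coeff g = 0 := by
  intro σ _ _ n F₀ F₁ D U V T x hD hT hx hF₀ hF₁
  refine eval_truncTotal_vanish F₀ F₁ D U V T x (fun j d _ => ?_) hT hx hF₀ hF₁
  rw [hD]
  simp

open CorankTwoEvaluation in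
/-- **(H) Evaluation of an `A⟦X⟧`-ideal membership with power-series generators** (helper of the
stub `stub_nondegenerateCorankTwo`).  `A = ℂ⟦W_s : s ∈ σ⟧`; if `C D = U F₀ + V F₁` in `A⟦X⟧` for
power series `F₀, F₁ ∈ A⟦X⟧`, and Laurent series `T_s`, `x` of positive order make the polynomial
truncations `τF_a := Σ_{j<n} (truncTotal n [X^j] F_a) X^j ∈ ℂ[W][X]` vanish below `t^n` when
evaluated at `W := T`, `X := x`, then `truncTotal n D ∈ ℂ[W]` evaluated at `T` vanishes below
`t^n`. -/
theorem evaluation_powerSeries :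
    ∀ (σ : Type) [Fintype σ] [DecidableEq σ] (n : ℕ) (F₀ F₁ : PowerSeries (MvPowerSeries σ ℂ))
      (D : MvPowerSeries σ ℂ) (U V : PowerSeries (MvPowerSeries σ ℂ)) (T : σ → LaurentSeries ℂ) (x : LaurentSeries ℂ),
      PowerSeries.C D = U * F₀ + V * F₁ →
      (∀ i, ∀ g : ℤ, g < 1 → (T i).coeff g = 0) → (∀ g : ℤ, g < 1 → x.coeff g = 0) →
      (∀ g : ℤ, g < n → (Polynomial.eval₂ (MvPolynomial.aeval T).toRingHom x
        (∑ j ∈ Finset.range n, Polynomial.monomial j (MvPowerSeries.truncTotal n (PowerSeries.coeff j F₀)))).coeff g = 0) →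
      (∀ g : ℤ, g < n → (Polynomial.eval₂ (MvPolynomial.aeval T).toRingHom x
        (∑ j ∈ Finset.range n, Polynomial.monomial j (MvPowerSeries.truncTotal n (PowerSeries.coeff j F₁)))).coeff g = 0) →
      ∀ g : ℤ, g < n → (MvPolynomial.aeval T (MvPowerSeries.truncTotal n D)).coeff g = 0 := by
  intro σ _ _ n F₀ F₁ D U V T x hD hT hx hF₀ hF₁
  refine eval_truncTotal_vanish _ _ D U V T x (fun j d hjd => ?_) hT hx hF₀ hF₁
  -- `C D - U τF₀ - V τF₁ = U (F₀ - τF₀) + V (F₁ - τF₁)` is small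
  rw [hD, show ∀ a b a' b' : PowerSeries (MvPowerSeries σ ℂ),
    U * a + V * b - U * a' - V * b' = U * (a - a') + V * (b - b') from fun _ _ _ _ => by ring,
    map_add, map_add, small_mul_right U (small_self_sub_trunc F₀) j d hjd,
    small_mul_right V (small_self_sub_trunc F₁) j d hjd, add_zero]

end Summit.ValiantsHypothesis.ValiantsHypothesis.Theorems.BinomialCandidateStubs

end
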